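import Literature.NumberTheory.EllipticCurves.TwoIsogenyShaTwoTorsion
import HarnessLib

/-!
# `Ш(E')[φ̂] = 0 ⇒ Ш(E)[2] = Ш(E)[φ]`: the `2`-torsion of `Ш` is carried by the homogeneous spaces of one
# `2`-isogeny when the dual descent is sharp (Silverman, AEC, Thm. X.4.2(a) with III.6.1; the exact sequence
# `0 → Ш(E)[φ] → Ш(E)[2] → Ш(E')[φ̂]`)

Topic `NumberTheory/EllipticCurves`. Sibling of `TwoIsogenyShaTwoTorsion` (which proves `Ш(V)[φ] = 0 ∧ Ш(V')[φ̂] = 0 ⇒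
Ш(V)[2] = 0`). Silverman, *AEC*, proof of Prop. X.6.2(c), uses «the exact sequence `0 → Ш(E/ℚ)[φ] → Ш(E/ℚ)[2] → Ш(E'/ℚ)[φ̂]`»;
here its one-sided consequence, for `V` in two-torsion normal form over a number field with `φ = φ_V : V → V'`:

* `mem_range_twoIsogenyTorsorHom_of_mem_sha_of_two_smul_eq_zero` — if `Ш(V'/K) ∩ im Ξ_{V'} = ⊥` (`Ш(V')[φ̂] = 0`), then every
  `c ∈ Ш(V/K)` with `2c = 0` lies in `im Ξ_V` (`= ker φ_*`, the classes of the homogeneous spaces `C_d`): `φ̂_*(φ_* c) = 2c = 0`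
  puts `φ_* c` in `Ш(V') ∩ ker φ̂_* = Ш(V') ∩ im Ξ_{V'} = ⊥`, so `c ∈ ker φ_* = im Ξ_V`;
* `sha_inf_torsionBy_two_eq_sha_inf_range` — hence **`Ш(V/K)[2] = Ш(V/K) ∩ im Ξ_V`** as subgroups of `H¹(K, V)`
  (the classes `Ξ[d]` are killed by `2`), so `#Ш(V)[2]` is the factor `#(Ш(V) ∩ im Ξ)` of the tree's Selmer counts
  (`TwoIsogenySelmerGroupSha`): this is the step «`Ш(E_p/ℚ)[φ] = Ш(E_p/ℚ)[2]`» of AEC Prop. X.6.5(b) left open in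
  `TwoIsogenySelmerXCubeAddPXSha`, and the step that upgrades the isogeny-door counts `#Ш(X)[φ] = 4`
  (`XCubeSub8XSqAddXSha`, `Curve346NontrivialSha`) to `Ш(X/ℚ)[2] ≅ (ℤ/2ℤ)²`.

Theorems only; no definitions, no named facts.

## References

* [SilvermanAEC2009] J. H. Silverman, *AEC*, 2nd ed.: Thm. X.4.2(a), Thm. III.6.1(a), proof of Prop. X.6.2(c) (the exact
  sequence `0 → Ш[φ] → Ш[2] → Ш'[φ̂]`), Prop. X.6.5(b).
-/

noncomputable section

open scoped Classical

universe u

namespace WeierstrassCurve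

open Literature.NumberTheory.EllipticCurves
open _root_.WeierstrassCurve.Affine (SqUnits)

variable {K : Type u} [Field K] [NumberField K] (V : WeierstrassCurve K) [V.IsTwoTorsionNF] [V.IsElliptic]

/-- **`Ш(V')[φ̂] = 0 ⇒ Ш(V)[2] ⊆ im Ξ_V`**: if `Ш(V'/K) ∩ im Ξ_{V'} = ⊥` then every `c ∈ Ш(V/K)` with `2c = 0` is the class of
a homogeneous space of `φ` (`c ∈ im Ξ_V = ker φ_*`): `φ̂_* (φ_* c) = 2c = 0`, so `φ_* c ∈ Ш(V') ∩ ker φ̂_* = Ш(V') ∩ im Ξ_{V'} = ⊥`.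
This is the exactness of `0 → Ш(E)[φ] → Ш(E)[2] → Ш(E')[φ̂]` used in the proof of AEC Prop. X.6.2(c).
[cite: SilvermanAEC2009, Thm. X.4.2(a) and Thm. III.6.1(a); proof of Prop. X.6.2(c)] -/
theorem mem_range_twoIsogenyTorsorHom_of_mem_sha_of_two_smul_eq_zero
    (hV' : V.twoIsogenyCodomain.sha ⊓
      AddMonoidHom.range (G := Additive (SqUnits K)) V.twoIsogenyCodomain.twoIsogenyTorsorHom = ⊥)
    {c : V.galH1} (hc : c ∈ V.sha) (h2 : 2 • c = 0) :
    c ∈ AddMonoidHom.range (G := Additive (SqUnits K)) V.twoIsogenyTorsorHom := by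
  obtain ⟨ψ, hψφ, -⟩ := V.exists_isogeny_comp_twoIsogeny_eq_two
  -- `φ_* c ∈ Ш(V')`
  have hφc : galH1Map V.twoIsogenyGeomHom (twoIsogenyGeomHom_smul V) c ∈ V.twoIsogenyCodomain.sha :=
    galH1Map_mem_sha V.twoIsogenyGeomHom (twoIsogenyGeomHom_smul V)
      V.twoIsogeny.hasLocalPointsMaps_toAddMonoidHom hc
  -- `φ̂_* (φ_* c) = 2 • c = 0`
  have hψc : galH1Map ψ.toAddMonoidHom ψ.equivariant
      (galH1Map V.twoIsogenyGeomHom (twoIsogenyGeomHom_smul V) c) = 0 := by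
    rw [galH1Map_galH1Map_of_comp_eq_nsmul V.twoIsogenyGeomHom (twoIsogenyGeomHom_smul V)
      ψ.toAddMonoidHom ψ.equivariant hψφ c, h2]
  -- hence `φ_* c ∈ Ш(V') ∩ im Ξ_{V'} = ⊥`
  have hφc0 : galH1Map V.twoIsogenyGeomHom (twoIsogenyGeomHom_smul V) c = 0 := by
    have hmem : galH1Map V.twoIsogenyGeomHom (twoIsogenyGeomHom_smul V) c ∈
        AddMonoidHom.range (G := Additive (SqUnits K)) V.twoIsogenyCodomain.twoIsogenyTorsorHom := by
      rw [range_twoIsogenyTorsorHom_eq_ker_galH1Map,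
        ← ker_galH1Map_eq_of_comp_twoIsogeny ψ.toAddMonoidHom ψ.equivariant (fun P ↦ ?_),
        AddMonoidHom.mem_ker]
      · exact hψc
      · rw [hψφ, ← natCast_zsmul]
    exact AddSubgroup.mem_bot.mp (hV'.le (AddSubgroup.mem_inf.mpr ⟨hφc, hmem⟩))
  -- so `c ∈ ker φ_* = im Ξ_V`
  rw [range_twoIsogenyTorsorHom_eq_ker_galH1Map, AddMonoidHom.mem_ker]
  exact hφc0

/-- **`Ш(V')[φ̂] = 0 ⇒ Ш(V/K)[2] = Ш(V/K) ∩ im Ξ_V`** as subgroups of `H¹(K, V)`: the `2`-torsion of `Ш(V)` consists exactly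
of the classes of the everywhere-locally-soluble homogeneous spaces `C_d` of `φ` (the classes `Ξ[d]` being killed by `2`,
`two_nsmul_twoIsogenyTorsorHom`). In particular `#Ш(V/K)[2]` is the factor `#(Ш(V) ∩ im Ξ)` of the tree's count
`2^{dim₂ S'} = #ᾱ(V'(K)) · #(Ш(V) ∩ im Ξ)` — the identification «`Ш(E_p/ℚ)[φ] = Ш(E_p/ℚ)[2]`» of AEC Prop. X.6.5(b).
[cite: SilvermanAEC2009, Prop. X.6.5(b) with Thm. X.4.2(a)] -/
theorem sha_inf_torsionBy_two_eq_sha_inf_range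
    (hV' : V.twoIsogenyCodomain.sha ⊓
      AddMonoidHom.range (G := Additive (SqUnits K)) V.twoIsogenyCodomain.twoIsogenyTorsorHom = ⊥) :
    V.sha ⊓ AddSubgroup.torsionBy V.galH1 2 =
      V.sha ⊓ AddMonoidHom.range (G := Additive (SqUnits K)) V.twoIsogenyTorsorHom := by
  ext c
  simp only [AddSubgroup.mem_inf]
  constructor
  · rintro ⟨hc, ht⟩
    have h2 : 2 • c = 0 := (AddSubgroup.torsionBy.nsmul_iff (n := 2)).mp ht
    exact ⟨hc, V.mem_range_twoIsogenyTorsorHom_of_mem_sha_of_two_smul_eq_zero hV' hc h2⟩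
  · rintro ⟨hc, ⟨x, hx⟩⟩
    refine ⟨hc, (AddSubgroup.torsionBy.nsmul_iff (n := 2)).mpr ?_⟩
    rw [← hx]
    exact two_nsmul_twoIsogenyTorsorHom _ x

/-- **A trivial count forces `Ш(V) ∩ im Ξ = ⊥`**: if `#(Ш(V/K) ∩ im Ξ_V) = 1` (e.g. from `2^{dim₂ S} = #α · #(Ш ∩ im Ξ)` with a
sharp Selmer bound), the subgroup is `⊥`. [cite: SilvermanAEC2009, Thm. X.4.2(a)] -/
theorem sha_inf_range_eq_bot_of_natCard_eq_one
    (h : Nat.card ↥(V.sha ⊓ AddMonoidHom.range (G := Additive (SqUnits K)) V.twoIsogenyTorsorHom) = 1) :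
    V.sha ⊓ AddMonoidHom.range (G := Additive (SqUnits K)) V.twoIsogenyTorsorHom = ⊥ := by
  haveI : Finite ↥(V.sha ⊓ AddMonoidHom.range (G := Additive (SqUnits K)) V.twoIsogenyTorsorHom) :=
    Nat.finite_of_card_ne_zero (by rw [h]; norm_num)
  exact AddSubgroup.eq_bot_of_card_le _ (by rw [h])

end WeierstrassCurve

end
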